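import Summits.Ventures.HodgeRepro2.T5FinitePlaceQuadratic

/-!
# `Kᵥ ⊗[K] L ≃ L_w` when `[L_w : Kᵥ] = [L : K]`, and the extension of automorphisms to the completion
(cell pub-hodge-repro2, seat p3)

Tier-5 N2 support, §N2.9.2 of route/T5-N2-route-3.md («completions») at the finite places, continued from files
115–116 (T5FinitePlaceLiesOver, T5FinitePlaceQuadratic). At a place `w ∣ v` where the local degree is the global one,
`[L_w : Kᵥ] = [L : K]`, the surjection `Kᵥ ⊗[K] L → L_w` of file 115 is an isomorphism of `Kᵥ`-algebras
(`tensorLiftEquiv`), and every `K`-automorphism `σ` of `L` extends to a `Kᵥ`-automorphism `extendAut σ` of `L_w`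
acting as `σ` on `L` (`extendAut_algebraMap`), functorially (`extendAut_refl`, `extendAut_trans`), an involution
when `σ` is (`extendAut_extendAut`). For the quadratic case `E = F(s)`, `s² = θ ∈ F`, at a NON-SPLIT place
(`θ` not a `v`-adic square, file 116): `E_w = F_v ⊗_F E` (`tensorLiftEquivOfNotIsSquare`) and the conjugation
`c : E ≃ₐ[F] E`, `c s = −s`, extends to the local conjugation of `E_w` over `F_v` with `√θ ↦ −√θ`
(`extendAutOfNotIsSquare_apply_s`) — the finite-place counterpart of file 108 (the archimedean `c ⊗ 1`); at a SPLIT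
place (`θ` a `v`-adic square) `completionMap : F_v ≃ E_w` (`completionEquivOfIsSquare`).
Mathlib + files 115–116 only. No display; no device. §8(d): uses an L-value-free non-vanishing device: NO.
-/

namespace Summit.Ventures.HodgeRepro2.T5FinitePlaceTensorEquiv

open IsDedekindDomain IsDedekindDomain.HeightOneSpectrum NumberField Module
open scoped Summit.Ventures.HodgeRepro2.T5FinitePlaceLiesOver TensorProduct
open Summit.Ventures.HodgeRepro2.T5FinitePlaceLiesOver Summit.Ventures.HodgeRepro2.T5FinitePlaceQuadratic

section General

variable {K L : Type*} [Field K] [NumberField K] [Field L] [NumberField L] [Algebra K L]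
variable (v : HeightOneSpectrum (𝓞 K)) (w : HeightOneSpectrum (𝓞 L)) [w.asIdeal.LiesOver v.asIdeal]

/-- When `[L_w : Kᵥ] = [L : K]`, the surjection `Kᵥ ⊗[K] L → L_w` is bijective (equal finite dimensions). -/
theorem tensorLift_bijective (h : finrank (v.adicCompletion K) (w.adicCompletion L) = finrank K L) :
    Function.Bijective (tensorLift v w) := by
  haveI := finite v w
  have hfin : finrank (v.adicCompletion K) ((v.adicCompletion K) ⊗[K] L) =
      finrank (v.adicCompletion K) (w.adicCompletion L) := by
    rw [Module.finrank_baseChange, h]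
  exact ⟨(LinearMap.injective_iff_surjective_of_finrank_eq_finrank
    (f := (tensorLift v w).toLinearMap) hfin).mpr (tensorLift_surjective v w), tensorLift_surjective v w⟩

/-- **`Kᵥ ⊗[K] L ≃ₐ[Kᵥ] L_w`** when `[L_w : Kᵥ] = [L : K]`. -/
noncomputable def tensorLiftEquiv (h : finrank (v.adicCompletion K) (w.adicCompletion L) = finrank K L) :
    (v.adicCompletion K) ⊗[K] L ≃ₐ[v.adicCompletion K] w.adicCompletion L :=
  AlgEquiv.ofBijective (tensorLift v w) (tensorLift_bijective v w h)

/-- `tensorLiftEquiv` is `tensorLift`. -/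
theorem tensorLiftEquiv_apply (h : finrank (v.adicCompletion K) (w.adicCompletion L) = finrank K L)
    (x : (v.adicCompletion K) ⊗[K] L) : tensorLiftEquiv v w h x = tensorLift v w x := rfl

/-- `tensorLiftEquiv (a ⊗ l) = a · l`. -/
theorem tensorLiftEquiv_tmul (h : finrank (v.adicCompletion K) (w.adicCompletion L) = finrank K L)
    (a : v.adicCompletion K) (l : L) :
    tensorLiftEquiv v w h (a ⊗ₜ l) =
      algebraMap (v.adicCompletion K) (w.adicCompletion L) a * algebraMap L (w.adicCompletion L) l :=
  tensorLift_tmul v w a l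

/-- `algebraMap L L_w x = tensorLiftEquiv (1 ⊗ x)`. -/
theorem algebraMap_eq_tensorLiftEquiv_one_tmul
    (h : finrank (v.adicCompletion K) (w.adicCompletion L) = finrank K L) (x : L) :
    algebraMap L (w.adicCompletion L) x = tensorLiftEquiv v w h (1 ⊗ₜ x) := by
  rw [tensorLiftEquiv_tmul, map_one, one_mul]

/-- **Extension of automorphisms:** a `K`-automorphism `σ` of `L` extends to the `Kᵥ`-automorphism
`tensorLiftEquiv ∘ (1 ⊗ σ) ∘ tensorLiftEquiv⁻¹` of `L_w`. -/
noncomputable def extendAut (h : finrank (v.adicCompletion K) (w.adicCompletion L) = finrank K L)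
    (σ : L ≃ₐ[K] L) : w.adicCompletion L ≃ₐ[v.adicCompletion K] w.adicCompletion L :=
  (tensorLiftEquiv v w h).symm.trans
    ((Algebra.TensorProduct.congr
      (AlgEquiv.refl : (v.adicCompletion K) ≃ₐ[v.adicCompletion K] (v.adicCompletion K)) σ).trans
      (tensorLiftEquiv v w h))

/-- `extendAut σ` acts as `σ` on `L`. -/
theorem extendAut_algebraMap (h : finrank (v.adicCompletion K) (w.adicCompletion L) = finrank K L)
    (σ : L ≃ₐ[K] L) (x : L) :
    extendAut v w h σ (algebraMap L (w.adicCompletion L) x) = algebraMap L (w.adicCompletion L) (σ x) := by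
  rw [algebraMap_eq_tensorLiftEquiv_one_tmul v w h x, algebraMap_eq_tensorLiftEquiv_one_tmul v w h (σ x)]
  simp only [extendAut, AlgEquiv.trans_apply, AlgEquiv.symm_apply_apply, Algebra.TensorProduct.congr_apply,
    Algebra.TensorProduct.map_tmul, AlgEquiv.coe_refl, id_eq, AlgEquiv.coe_toAlgHom]

/-- `extendAut σ` fixes `Kᵥ`. -/
theorem extendAut_algebraMap_left (h : finrank (v.adicCompletion K) (w.adicCompletion L) = finrank K L)
    (σ : L ≃ₐ[K] L) (a : v.adicCompletion K) :
    extendAut v w h σ (algebraMap (v.adicCompletion K) (w.adicCompletion L) a) =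
      algebraMap (v.adicCompletion K) (w.adicCompletion L) a :=
  AlgEquiv.commutes _ a

/-- `extendAut` of the identity is the identity. -/
theorem extendAut_refl (h : finrank (v.adicCompletion K) (w.adicCompletion L) = finrank K L) :
    extendAut v w h AlgEquiv.refl = AlgEquiv.refl := by
  refine AlgEquiv.ext fun x => ?_
  simp [extendAut, Algebra.TensorProduct.congr_refl]

/-- `extendAut` is functorial: `extendAut (σ.trans τ) = (extendAut σ).trans (extendAut τ)`. -/
theorem extendAut_trans (h : finrank (v.adicCompletion K) (w.adicCompletion L) = finrank K L)
    (σ τ : L ≃ₐ[K] L) :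
    extendAut v w h (σ.trans τ) = (extendAut v w h σ).trans (extendAut v w h τ) := by
  refine AlgEquiv.ext fun x => ?_
  simp only [extendAut, AlgEquiv.trans_apply, AlgEquiv.symm_apply_apply, Algebra.TensorProduct.congr_apply]
  congr 1
  generalize (tensorLiftEquiv v w h).symm x = y
  induction y using TensorProduct.induction_on with
  | zero => simp only [map_zero]
  | add a b ha hb => simp only [map_add, ha, hb]
  | tmul a l => rfl

/-- An involution of `L` extends to an involution of `L_w`. -/
theorem extendAut_extendAut (h : finrank (v.adicCompletion K) (w.adicCompletion L) = finrank K L)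
    (σ : L ≃ₐ[K] L) (hσ : σ.trans σ = AlgEquiv.refl) (y : w.adicCompletion L) :
    extendAut v w h σ (extendAut v w h σ y) = y := by
  have := congrArg (fun e => e y) (extendAut_trans v w h σ σ)
  simp only [AlgEquiv.trans_apply, hσ, extendAut_refl, AlgEquiv.coe_refl, id_eq] at this
  exact this.symm

end General

section Quadratic

variable {F E : Type*} [Field F] [NumberField F] [Field E] [NumberField E] [Algebra F E]
variable (v : HeightOneSpectrum (𝓞 F)) (w : HeightOneSpectrum (𝓞 E)) [w.asIdeal.LiesOver v.asIdeal]
variable {s : E} {θ : F}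

/-- **`F_v ≃ E_w` at a split place** (`θ` a `v`-adic square): `completionMap` is bijective. -/
noncomputable def completionEquivOfIsSquare (hs : s ^ 2 = algebraMap F E θ)
    (hspan : Submodule.span F {(1 : E), s} = ⊤) (hsq : IsSquare (algebraMap F (v.adicCompletion F) θ)) :
    v.adicCompletion F ≃+* w.adicCompletion E :=
  RingEquiv.ofBijective (completionMap F E v w) ((bijective_completionMap_iff_isSquare v w hs hspan).mpr hsq)

/-- `completionEquivOfIsSquare` is `completionMap`. -/
theorem completionEquivOfIsSquare_apply (hs : s ^ 2 = algebraMap F E θ)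
    (hspan : Submodule.span F {(1 : E), s} = ⊤) (hsq : IsSquare (algebraMap F (v.adicCompletion F) θ))
    (x : v.adicCompletion F) : completionEquivOfIsSquare v w hs hspan hsq x = completionMap F E v w x := rfl

variable [Algebra.IsQuadraticExtension F E]

/-- At a non-split place (`θ` not a `v`-adic square) the local degree is the global one, `2`. -/
theorem finrank_eq_of_not_isSquare (hs : s ^ 2 = algebraMap F E θ)
    (hspan : Submodule.span F {(1 : E), s} = ⊤) (hsq : ¬ IsSquare (algebraMap F (v.adicCompletion F) θ)) :
    finrank (v.adicCompletion F) (w.adicCompletion E) = finrank F E := by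
  rw [(finrank_eq_two_iff_not_isSquare v w hs hspan).mpr hsq, Algebra.IsQuadraticExtension.finrank_eq_two F E]

/-- **`E_w = F_v ⊗_F E` at a non-split place.** -/
noncomputable def tensorLiftEquivOfNotIsSquare (hs : s ^ 2 = algebraMap F E θ)
    (hspan : Submodule.span F {(1 : E), s} = ⊤) (hsq : ¬ IsSquare (algebraMap F (v.adicCompletion F) θ)) :
    (v.adicCompletion F) ⊗[F] E ≃ₐ[v.adicCompletion F] w.adicCompletion E :=
  tensorLiftEquiv v w (finrank_eq_of_not_isSquare v w hs hspan hsq)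

/-- **The local conjugation at a non-split place:** the extension of `c : E ≃ₐ[F] E` to `E_w` over `F_v`. -/
noncomputable def extendAutOfNotIsSquare (hs : s ^ 2 = algebraMap F E θ)
    (hspan : Submodule.span F {(1 : E), s} = ⊤) (hsq : ¬ IsSquare (algebraMap F (v.adicCompletion F) θ))
    (c : E ≃ₐ[F] E) : w.adicCompletion E ≃ₐ[v.adicCompletion F] w.adicCompletion E :=
  extendAut v w (finrank_eq_of_not_isSquare v w hs hspan hsq) c

/-- The local conjugation acts as `c` on `E`. -/
theorem extendAutOfNotIsSquare_algebraMap (hs : s ^ 2 = algebraMap F E θ)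
    (hspan : Submodule.span F {(1 : E), s} = ⊤) (hsq : ¬ IsSquare (algebraMap F (v.adicCompletion F) θ))
    (c : E ≃ₐ[F] E) (x : E) :
    extendAutOfNotIsSquare v w hs hspan hsq c (algebraMap E (w.adicCompletion E) x) =
      algebraMap E (w.adicCompletion E) (c x) :=
  extendAut_algebraMap v w _ c x

/-- **`√θ ↦ −√θ`:** if `c s = −s` then the local conjugation sends the image of `s` to its negative. -/
theorem extendAutOfNotIsSquare_apply_s (hs : s ^ 2 = algebraMap F E θ)
    (hspan : Submodule.span F {(1 : E), s} = ⊤) (hsq : ¬ IsSquare (algebraMap F (v.adicCompletion F) θ))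
    (c : E ≃ₐ[F] E) (hc : c s = -s) :
    extendAutOfNotIsSquare v w hs hspan hsq c (algebraMap E (w.adicCompletion E) s) =
      -(algebraMap E (w.adicCompletion E) s) := by
  rw [extendAutOfNotIsSquare_algebraMap, hc, map_neg]

/-- The local conjugation is an involution when `c` is. -/
theorem extendAutOfNotIsSquare_extendAutOfNotIsSquare (hs : s ^ 2 = algebraMap F E θ)
    (hspan : Submodule.span F {(1 : E), s} = ⊤) (hsq : ¬ IsSquare (algebraMap F (v.adicCompletion F) θ))
    (c : E ≃ₐ[F] E) (hc : c.trans c = AlgEquiv.refl) (y : w.adicCompletion E) :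
    extendAutOfNotIsSquare v w hs hspan hsq c (extendAutOfNotIsSquare v w hs hspan hsq c y) = y :=
  extendAut_extendAut v w _ c hc y

end Quadratic

end Summit.Ventures.HodgeRepro2.T5FinitePlaceTensorEquiv
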